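import Summits.QuantumFields.YangMills.Theses.FradkinShenkerFlow
import Literature.MathematicalPhysics.QuantumFieldTheory.ConstructiveQFTWave0OddRPProofs
import Literature.MathematicalPhysics.QuantumFieldTheory.LatticeGaugeStaticPotentialProofs
import Literature.MathematicalPhysics.QuantumFieldTheory.LatticeGaugeProofs
import Literature.MathematicalPhysics.QuantumFieldTheory.QCDTimeReflection
import Literature.Probability.LatticeModels.SharpnessProofs

/-!
# Candidate proof of STUB 2b `stub_mirrorDominationAxis0` (line `sup-axis-reflection-transfer`,
crux stmt-QuantumFields-9442) — refuter drefute g2 by-product (positive; attached as item evidence,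
a prover lands it under `Theorems/` with `propose --supports stmt-QuantumFields-9442`)

`OddTorusRPCauchySchwarz → MirrorDominationAxis0`, theorem `MirrorCore.mirrorDominationAxis0` below,
with the VERBATIM registered signature (lean check rc0, 0 sorry, 0 warnings; axioms propext /
Classical.choice / Quot.sound; plugged into the registered skeleton sha 33388a4b85c5 it leaves exactly
the other stubs' sorries).

Proof = the mirror Cauchy–Schwarz bookkeeping of the line card, with every convention kernel-checked:
* §0–§1 `torusLift_timeReflect` (`lift ∘ Θ₀ = τ_{e₀} ∘ cfgReflect ∘ lift`), `cfgReflect_configShift`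
  (`cfgReflect ∘ τ_w = τ_{σw} ∘ cfgReflect`), `torusLift_theta` (`lift ∘ Θ_{p e₀} = τ_{(2p+1)e₀} ∘ cfgReflect ∘ lift`);
* §2 the mirror species `reflSpecies A = A ∘ cfgReflect` (a `YMSpecies`), `F_eq`
  (`A∘lift∘Θ_p = A^R ∘ τ_{(2p+1)e₀} ∘ lift`), `G_theta_eq`;
* §3 torus covariance bookkeeping: `cov_rebase` (translation invariance), `cov_swap'`, `cov_wrap`
  (a lag `m ∈ (S, 2S]` is the lag `2S+1-m` of the swapped pair);
* §4 the two `DependsOn` obligations of STUB 2a (`dependsOn_F`, `dependsOn_G`: explicit `ZMod` time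
  coordinates in the un-wrapped range);
* §5 `two_le_sum`; §6 the assembly: witnesses `k = 4`, `(P, Q) = (A, A^R), (A^R, A), (B^R, B), (B, B^R)`,
  `c = 1/2` (AM–GM on the discriminant inequality), `w = R_A + R_B + 1`, `n₀ = 3(R_A + R_B) + 3` with the
  crude extents `R_X = 1 + max_{e ∈ supp X} |e.1 0|`, plane `p = ⌊(n + R_A - R_B)/2⌋`, lags `m₁ = 2p+1`
  (`D_A = Cov_S(A, τ_{m₁} A^R)`) and `m₂ = 2n-2p-1` (`D_B = Cov_S(B^R, τ_{m₂} B)`), each realised as itself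
  (`≤ S`) or wrapped; all side conditions discharged by `omega`.
-/

noncomputable section

open MeasureTheory ProbabilityTheory
open scoped BigOperators
open Literature.MathematicalPhysics.QuantumFieldTheory hiding Site ZdEdge
open Literature.MathematicalPhysics.QuantumLattice
open Literature.Probability.LatticeModels hiding configShift configShift_apply

namespace Summit.QuantumFields.YangMills.Cruxes.FiniteSusceptibilityWeakCoupling.SupAxisReflectionTransfer.MirrorCore

/-! ## §0 Site / torus bookkeeping (no group) -/

section NoGroup

/-- `siteReflect` is additive. [folklore] -/
theorem siteReflect_sub (x y : Site 4) : siteReflect (x - y) = siteReflect x - siteReflect y := by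
  funext k
  by_cases hk : k = 0
  · subst hk; simp; ring
  · simp [siteReflect_apply_of_ne _ hk]

/-- `σ (c e₀) = -(c e₀)`. [folklore] -/
theorem siteReflect_single_zero (c : ℤ) : siteReflect (Pi.single 0 c : Site 4) = -Pi.single 0 c := by
  funext k
  by_cases hk : k = 0
  · subst hk; simp
  · simp [siteReflect_apply_of_ne _ hk, hk]

/-- `Torus.proj` is odd. [folklore] -/
theorem proj_neg (L : ℕ) (y : Site 4) : Torus.proj L (-y) = -Torus.proj L y := by
  funext i; simp [Torus.proj_apply]

/-- `sitePerm 1 = id`. [folklore] -/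
@[simp] theorem sitePerm_one {L : ℕ} (y : Literature.MathematicalPhysics.QuantumFieldTheory.Site 4 L) :
    sitePerm (1 : Equiv.Perm (Fin 4)) y = y := rfl

variable {G : Type} [MeasurableSpace G]

/-- Composition of translations. [folklore] -/
theorem configShift_configShift (a b : Site 4) (W : LGConfig 4 G) :
    configShift a (configShift b W) = configShift (a + b) W := by
  funext e
  simp only [configShift_apply]
  congr 1
  ext1
  · simp only; abel
  · rfl

/-- `configPerm 1 = id`. [folklore] -/
@[simp] theorem configPerm_one {L : ℕ} (U : GaugeConfig 4 L G) :
    configPerm (1 : Equiv.Perm (Fin 4)) U = U := by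
  funext e; rw [configPerm_apply]; rfl

/-- The periodic lift intertwines `configShift v` with the torus shift by `v mod L`
(as in the lead's `MirrorReduction.configShift_torusLift`). [folklore] -/
theorem configShift_torusLift (L : ℕ) (v : Site 4) (U : GaugeConfig 4 L G) :
    configShift v (torusLift L U) = torusLift L (torusConfigShift (Torus.proj L v) U) :=
  congrFun (toTorusObservable_comp_configShift (G := G) L v id) U

end NoGroup

/-! ## §1 The mirror species -/

section GroupOnly

variable {G : Type} [Group G] [MeasurableSpace G]

omit [MeasurableSpace G] in
/-- `cfgReflect U` at `e` only reads `U` at `reflectEdge e`. [folklore] -/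
theorem cfgReflect_congr {U V : LGConfig 4 G} {e : Literature.MathematicalPhysics.QuantumLattice.ZdEdge 4}
    (h : U (reflectEdge e) = V (reflectEdge e)) : cfgReflect U e = cfgReflect V e := by
  unfold cfgReflect
  split_ifs <;> simp [h]

/-- **`cfgReflect ∘ τ_w = τ_{σ w} ∘ cfgReflect`.** [folklore] -/
theorem cfgReflect_configShift (w : Site 4) (W : LGConfig 4 G) :
    cfgReflect (configShift w W) = configShift (siteReflect w) (cfgReflect W) := by
  funext ⟨y, i⟩
  by_cases hi : i = 0
  · subst hi
    simp only [cfgReflect, reflectEdge, ↓reduceIte, configShift_apply, siteReflect_sub,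
      siteReflect_siteReflect]
    congr 3
    abel
  · simp only [cfgReflect, reflectEdge, if_neg hi, configShift_apply, siteReflect_sub,
      siteReflect_siteReflect]

/-- **`lift ∘ Θ₀ = τ_{e₀} ∘ cfgReflect ∘ lift`**: the torus link reflection `θ t = 1 - t` read through
the periodic lift is the `ℤ⁴` site reflection followed by a unit time translation. [folklore] -/
theorem torusLift_timeReflect (L : ℕ) (U : GaugeConfig 4 L G) :
    torusLift L (GaugeConfig.timeReflect U) =
      configShift (Pi.single 0 1) (cfgReflect (torusLift L U)) := by
  funext ⟨y, i⟩
  simp only [torusLift, Function.comp_apply, torusEdge, GaugeConfig.timeReflect, configShift_apply,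
    cfgReflect, reflectEdge]
  by_cases hi : i = 0
  · subst hi
    simp only [↓reduceIte]
    congr 2
    refine Prod.ext ?_ rfl
    funext k
    by_cases hk : k = 0
    · subst hk
      simp [Literature.MathematicalPhysics.QuantumFieldTheory.Site.shift, Site.timeReflect,
        Torus.proj_apply, siteReflect_apply_zero]
    · simp [Literature.MathematicalPhysics.QuantumFieldTheory.Site.shift, Site.timeReflect,
        Torus.proj_apply, hk, siteReflect_apply_of_ne _ hk]
  · simp only [if_neg hi]
    congr 1
    refine Prod.ext ?_ rfl
    funext k
    by_cases hk : k = 0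
    · subst hk
      simp [Site.timeReflect, Torus.proj_apply, siteReflect_apply_zero]
    · simp [Site.timeReflect, Torus.proj_apply, hk, siteReflect_apply_of_ne _ hk]

/-- **`lift ∘ Θ_v = τ_{(2p+1)e₀} ∘ cfgReflect ∘ lift`** for the transported reflection of STUB 1 in the
plane `v = p e₀` (axis permutation `π = 1`). [folklore] -/
theorem torusLift_theta (L : ℕ) (p : ℤ) (U : GaugeConfig 4 L G) :
    torusLift L (torusConfigShift (Torus.proj L (Pi.single 0 p))
      (configPerm (1 : Equiv.Perm (Fin 4)) (GaugeConfig.timeReflect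
        (configPerm (1 : Equiv.Perm (Fin 4)).symm
          (torusConfigShift (-Torus.proj L (Pi.single 0 p)) U))))) =
      configShift (Pi.single 0 (2 * p + 1)) (cfgReflect (torusLift L U)) := by
  have h1 : (1 : Equiv.Perm (Fin 4)).symm = 1 := rfl
  rw [h1, configPerm_one, configPerm_one, ← configShift_torusLift,
    torusLift_timeReflect, ← proj_neg, ← configShift_torusLift, cfgReflect_configShift,
    configShift_configShift, configShift_configShift]
  have hv : (Pi.single 0 p + Pi.single 0 1 + siteReflect (-Pi.single 0 p) : Site 4) =
      Pi.single 0 (2 * p + 1) := by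
    funext k
    by_cases hk : k = 0
    · subst hk; simp; ring
    · simp [siteReflect_apply_of_ne _ hk, hk]
  rw [hv]

end GroupOnly

/-! ## §2 The mirror species -/

section Species

variable {G : Type} [Group G] [TopologicalSpace G] [IsTopologicalGroup G] [CompactSpace G]
  [MeasurableSpace G] [BorelSpace G]

/-- **The mirror species** `A^R := A ∘ cfgReflect`: a cylinder on the reflected support, gauge
invariant (`cfgReflect_gaugeTransformZd`), bounded, measurable. [folklore] -/
def reflSpecies (A : YMSpecies G) : YMSpecies G where
  F := A.F ∘ cfgReflect
  supp := A.supp.image reflectEdge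
  isCylinder := by
    intro U V hUV
    simp only [Function.comp_apply]
    refine A.isCylinder fun e he => cfgReflect_congr (hUV _ ?_)
    exact Finset.mem_coe.2 (Finset.mem_image_of_mem _ (Finset.mem_coe.1 he))
  gaugeInvariant := by
    intro g U
    simp only [Function.comp_apply, cfgReflect_gaugeTransformZd]
    exact A.gaugeInvariant _ _
  bounded := by
    obtain ⟨C, hC⟩ := A.bounded
    exact ⟨C, fun U => hC _⟩
  measurable := A.measurable.comp measurable_cfgReflect

omit [CompactSpace G] in
@[simp] theorem reflSpecies_F (A : YMSpecies G) (U : LGConfig 4 G) :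
    (reflSpecies A).F U = A.F (cfgReflect U) := rfl

omit [TopologicalSpace G] [IsTopologicalGroup G] [CompactSpace G] [BorelSpace G] in
/-- `σ` is odd. [folklore] -/
theorem siteReflect_neg (w : Site 4) : siteReflect (-w) = -siteReflect w := by
  funext k
  by_cases hk : k = 0
  · subst hk; simp
  · simp [siteReflect_apply_of_ne _ hk]

omit [CompactSpace G] in
/-- **`F := A∘lift∘Θ_v` is the translated mirror species**:
`A (lift (Θ_v U)) = A^R (τ_{(2p+1)e₀} (lift U))`. [folklore] -/
theorem F_eq (A : YMSpecies G) (L : ℕ) (p : ℤ) (U : GaugeConfig 4 L G) :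
    A.F (torusLift L (torusConfigShift (Torus.proj L (Pi.single 0 p))
      (configPerm (1 : Equiv.Perm (Fin 4)) (GaugeConfig.timeReflect
        (configPerm (1 : Equiv.Perm (Fin 4)).symm
          (torusConfigShift (-Torus.proj L (Pi.single 0 p)) U)))))) =
      (reflSpecies A).F (configShift (-Pi.single 0 (2 * p + 1)) (torusLift L U)) := by
  rw [torusLift_theta, reflSpecies_F, cfgReflect_configShift, siteReflect_neg, siteReflect_single_zero,
    neg_neg]

omit [CompactSpace G] in
/-- **`G' ∘ Θ_v` is a translate of the mirror species**:
`B (τ_x (lift (Θ_v U))) = B^R (configShift (σ(-x + (2p+1)e₀)) (lift U))`. [folklore] -/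
theorem G_theta_eq (B : YMSpecies G) (L : ℕ) (p : ℤ) (x : Site 4) (U : GaugeConfig 4 L G) :
    B.F (configShift (-x) (torusLift L (torusConfigShift (Torus.proj L (Pi.single 0 p))
      (configPerm (1 : Equiv.Perm (Fin 4)) (GaugeConfig.timeReflect
        (configPerm (1 : Equiv.Perm (Fin 4)).symm
          (torusConfigShift (-Torus.proj L (Pi.single 0 p)) U))))))) =
      (reflSpecies B).F (configShift (siteReflect (-x + Pi.single 0 (2 * p + 1))) (torusLift L U)) := by
  rw [torusLift_theta, configShift_configShift, reflSpecies_F, cfgReflect_configShift,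
    siteReflect_siteReflect]

/-! ## §3 Covariance bookkeeping on the torus -/

omit [Group G] [TopologicalSpace G] [IsTopologicalGroup G] [CompactSpace G] [BorelSpace G] in
/-- `configShift 0 = id`. [folklore] -/
theorem configShift_zero (W : LGConfig 4 G) : configShift (0 : Site 4) W = W := by
  funext e; simp [configShift_apply]

omit [Group G] [TopologicalSpace G] [IsTopologicalGroup G] [CompactSpace G] [BorelSpace G] in
/-- Periodicity of the lift: `configShift v ∘ lift` depends on `v mod L` only. [folklore] -/
theorem configShift_torusLift_congr (L : ℕ) {v v' : Site 4} (h : Torus.proj L v = Torus.proj L v')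
    (U : GaugeConfig 4 L G) : configShift v (torusLift L U) = configShift v' (torusLift L U) := by
  rw [configShift_torusLift, configShift_torusLift, h]

/-- **Re-basing by translation invariance**:
`Cov(f ∘ τ_u ∘ lift, g ∘ τ_a ∘ lift) = Cov(f ∘ lift, g ∘ τ_{a-u} ∘ lift)`. [folklore] -/
theorem cov_rebase (r : LatticeRep G) (β : ℝ) (S : ℕ) (f g : LGConfig 4 G → ℝ) (u a : Site 4) :
    cov[fun U => f (configShift u (torusLift (2 * S + 1) U)),
        fun U => g (configShift a (torusLift (2 * S + 1) U));
        wilsonMeasure (d := 4) (L := 2 * S + 1) r.ρ β] =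
      cov[fun U => f (torusLift (2 * S + 1) U),
        fun U => g (configShift (a - u) (torusLift (2 * S + 1) U));
        wilsonMeasure (d := 4) (L := 2 * S + 1) r.ρ β] := by
  symm
  conv_lhs => rw [← wilsonMeasure_map_torusConfigShift r.ρ β (Torus.proj (2 * S + 1) u)]
  rw [covariance_map_equiv]
  congr 1
  · funext U
    simp only [Function.comp_apply, ← configShift_torusLift]
  · funext U
    simp only [Function.comp_apply, ← configShift_torusLift, configShift_configShift, sub_add_cancel]

/-- **Pair swap**: `Cov(f ∘ lift, g ∘ τ_{-y}... ) = Cov(g ∘ lift, f ∘ configShift y ∘ lift)`. [folklore] -/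
theorem cov_swap' (r : LatticeRep G) (β : ℝ) (S : ℕ) (f g : LGConfig 4 G → ℝ) (y : Site 4) :
    cov[fun U => f (torusLift (2 * S + 1) U),
        fun U => g (configShift (-y) (torusLift (2 * S + 1) U));
        wilsonMeasure (d := 4) (L := 2 * S + 1) r.ρ β] =
      cov[fun U => g (torusLift (2 * S + 1) U),
        fun U => f (configShift y (torusLift (2 * S + 1) U));
        wilsonMeasure (d := 4) (L := 2 * S + 1) r.ρ β] := by
  rw [covariance_comm]
  have h := cov_rebase r β S g f (-y) 0
  simp only [configShift_zero, zero_sub, neg_neg] at h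
  exact h

/-- **Wrap-around**: a lag `m ∈ (S, 2S]` along the time axis is the lag `2S+1-m ≤ S` of the swapped
pair. [folklore] -/
theorem cov_wrap (r : LatticeRep G) (β : ℝ) (S : ℕ) (f g : LGConfig 4 G → ℝ) (m : ℤ) (j : ℕ)
    (hj : (j : ℤ) = 2 * S + 1 - m) :
    cov[fun U => f (torusLift (2 * S + 1) U),
        fun U => g (configShift (-Pi.single 0 m) (torusLift (2 * S + 1) U));
        wilsonMeasure (d := 4) (L := 2 * S + 1) r.ρ β] =
      cov[fun U => g (torusLift (2 * S + 1) U),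
        fun U => f (configShift (-Pi.single 0 (j : ℤ)) (torusLift (2 * S + 1) U));
        wilsonMeasure (d := 4) (L := 2 * S + 1) r.ρ β] := by
  have hper : ∀ U : GaugeConfig 4 (2 * S + 1) G,
      configShift (-Pi.single 0 m) (torusLift (2 * S + 1) U) =
        configShift (-(-Pi.single 0 (j : ℤ))) (torusLift (2 * S + 1) U) := by
    intro U
    refine configShift_torusLift_congr _ ?_ U
    funext i
    simp only [Torus.proj_apply, Pi.neg_apply, neg_neg]
    by_cases hi : i = 0
    · subst hi
      simp only [Pi.single_eq_same, hj]
      push_cast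
      have hL : (2 * (S : ZMod (2 * S + 1)) + 1) = 0 := by
        exact_mod_cast ZMod.natCast_self (2 * S + 1)
      linear_combination (-1 : ZMod (2 * S + 1)) * hL
    · simp [hi]
  simp_rw [hper]
  exact cov_swap' r β S f g _

/-! ## §4 Support placement: the two `DependsOn` obligations of STUB 2a -/

omit [Group G] [TopologicalSpace G] [IsTopologicalGroup G] [CompactSpace G] [MeasurableSpace G]
  [BorelSpace G] in
/-- Time coordinate (as an integer) of a torus site `proj y - proj (p e₀)` in the un-wrapped range.
[folklore] -/
theorem val_sub_proj (S : ℕ) (y : Site 4) (p : ℤ) (h0 : 0 ≤ y 0 - p) (hL : y 0 - p < 2 * S + 1) :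
    (((Torus.proj (2 * S + 1) y - Torus.proj (2 * S + 1) (Pi.single 0 p) :
      Literature.MathematicalPhysics.QuantumFieldTheory.Site 4 (2 * S + 1)) 0).val : ℤ) = y 0 - p := by
  have h : (Torus.proj (2 * S + 1) y - Torus.proj (2 * S + 1) (Pi.single 0 p) :
      Literature.MathematicalPhysics.QuantumFieldTheory.Site 4 (2 * S + 1)) 0 =
      ((y 0 - p : ℤ) : ZMod (2 * S + 1)) := by
    simp [Int.cast_sub]
  rw [h, ZMod.val_intCast]
  exact Int.emod_eq_of_lt h0 (by exact_mod_cast hL)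

omit [Group G] [TopologicalSpace G] [IsTopologicalGroup G] [CompactSpace G] [MeasurableSpace G]
  [BorelSpace G] in
/-- Time coordinate of the reflected edge. [folklore] -/
theorem reflectEdge_fst_zero (e : Literature.MathematicalPhysics.QuantumLattice.ZdEdge 4) :
    (reflectEdge e).1 0 = -e.1 0 - (if e.2 = 0 then 1 else 0) := by
  unfold reflectEdge
  split_ifs with h <;> simp

omit [Group G] [TopologicalSpace G] [IsTopologicalGroup G] [CompactSpace G] [MeasurableSpace G]
  [BorelSpace G] in
/-- Direction of the reflected edge. [folklore] -/
theorem reflectEdge_snd (e : Literature.MathematicalPhysics.QuantumLattice.ZdEdge 4) :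
    (reflectEdge e).2 = e.2 := by
  unfold reflectEdge
  split_ifs with h <;> simp [h]

omit [TopologicalSpace G] [IsTopologicalGroup G] [CompactSpace G] [BorelSpace G] in
/-- **`τ_x B ∘ lift` lives in the positive half of the plane `p + ½`** once
`p + 1 + R_B ≤ x₀` and `R_B + x₀ ≤ p + S + 1`. [folklore] -/
theorem dependsOn_G (B : YMSpecies G) (S : ℕ) (hS : 1 ≤ S) (x : Site 4) (p : ℤ) (RB : ℕ)
    (hRB : ∀ e ∈ B.supp, (e.1 0).natAbs + 1 ≤ RB)
    (h1 : p + 1 + RB ≤ x 0) (h2 : (RB : ℤ) + x 0 ≤ p + S + 1) :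
    DependsOn (fun U : GaugeConfig 4 (2 * S + 1) G =>
        B.F (configShift (-x) (torusLift (2 * S + 1) U)))
      {e : Edge 4 (2 * S + 1) |
        WilsonOddRP.IsOPosEdge (sitePerm (1 : Equiv.Perm (Fin 4)).symm
            (e.1 - Torus.proj (2 * S + 1) (Pi.single 0 p)), (1 : Equiv.Perm (Fin 4)).symm e.2) ∨
        WilsonOddRP.IsOSharedEdge (sitePerm (1 : Equiv.Perm (Fin 4)).symm
            (e.1 - Torus.proj (2 * S + 1) (Pi.single 0 p)), (1 : Equiv.Perm (Fin 4)).symm e.2)} := by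
  intro U V hUV
  refine B.isCylinder fun e he => ?_
  simp only [configShift_apply, torusLift, Function.comp_apply, torusEdge]
  apply hUV
  have he' := hRB e (Finset.mem_coe.1 he)
  have hval := val_sub_proj S (e.1 - -x) p (by simp; omega) (by simp; omega)
  have hy : (e.1 - -x) 0 - p = e.1 0 + x 0 - p := by simp
  rw [hy] at hval
  change WilsonOddRP.IsOPosEdge (Torus.proj (2 * S + 1) (e.1 - -x) - Torus.proj (2 * S + 1)
      (Pi.single 0 p), e.2) ∨ WilsonOddRP.IsOSharedEdge (Torus.proj (2 * S + 1) (e.1 - -x) -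
      Torus.proj (2 * S + 1) (Pi.single 0 p), e.2)
  unfold WilsonOddRP.IsOPosEdge WilsonOddRP.IsOSharedEdge
  simp only
  have hdiv : (2 * S + 1) / 2 = S := by omega
  rw [hdiv]
  by_cases hi : e.2 = 0
  · left
    constructor <;> omega
  · by_cases hle : e.1 0 + x 0 - p ≤ S
    · left; constructor <;> omega
    · right; exact ⟨hi, by omega⟩

omit [CompactSpace G] in
/-- **`A ∘ lift ∘ Θ_p = A^R ∘ τ_{(2p+1)e₀} ∘ lift` lives in the positive half of the plane `p + ½`**
once `R_A ≤ p ≤ S - R_A`. [folklore] -/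
theorem dependsOn_F (A : YMSpecies G) (S : ℕ) (p : ℤ) (RA : ℕ)
    (hRA : ∀ e ∈ A.supp, (e.1 0).natAbs + 1 ≤ RA) (h1 : (RA : ℤ) ≤ p) (h2 : p + RA ≤ S) :
    DependsOn (fun U : GaugeConfig 4 (2 * S + 1) G =>
        (reflSpecies A).F (configShift (-Pi.single 0 (2 * p + 1)) (torusLift (2 * S + 1) U)))
      {e : Edge 4 (2 * S + 1) |
        WilsonOddRP.IsOPosEdge (sitePerm (1 : Equiv.Perm (Fin 4)).symm
            (e.1 - Torus.proj (2 * S + 1) (Pi.single 0 p)), (1 : Equiv.Perm (Fin 4)).symm e.2) ∨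
        WilsonOddRP.IsOSharedEdge (sitePerm (1 : Equiv.Perm (Fin 4)).symm
            (e.1 - Torus.proj (2 * S + 1) (Pi.single 0 p)), (1 : Equiv.Perm (Fin 4)).symm e.2)} := by
  intro U V hUV
  refine (reflSpecies A).isCylinder fun e' he' => ?_
  obtain ⟨e, he, rfl⟩ := Finset.mem_image.1 (Finset.mem_coe.1 he')
  simp only [configShift_apply, torusLift, Function.comp_apply, torusEdge]
  apply hUV
  have he'' := hRA e he
  have ht := reflectEdge_fst_zero e
  have h2' := reflectEdge_snd e
  have hval := val_sub_proj S ((reflectEdge e).1 - -Pi.single 0 (2 * p + 1)) p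
    (by simp; split_ifs at ht <;> omega) (by simp; split_ifs at ht <;> omega)
  have hy : ((reflectEdge e).1 - -Pi.single 0 (2 * p + 1) : Site 4) 0 - p = (reflectEdge e).1 0 + p + 1 := by
    simp; ring
  rw [hy] at hval
  change WilsonOddRP.IsOPosEdge (Torus.proj (2 * S + 1) ((reflectEdge e).1 - -Pi.single 0 (2 * p + 1)) -
      Torus.proj (2 * S + 1) (Pi.single 0 p), (reflectEdge e).2) ∨
    WilsonOddRP.IsOSharedEdge (Torus.proj (2 * S + 1) ((reflectEdge e).1 - -Pi.single 0 (2 * p + 1)) -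
      Torus.proj (2 * S + 1) (Pi.single 0 p), (reflectEdge e).2)
  unfold WilsonOddRP.IsOPosEdge WilsonOddRP.IsOSharedEdge
  simp only
  have hdiv : (2 * S + 1) / 2 = S := by omega
  rw [hdiv, h2']
  by_cases hi : e.2 = 0
  · left
    rw [if_pos hi] at ht
    constructor <;> omega
  · rw [if_neg hi] at ht
    by_cases hle : (reflectEdge e).1 0 + p + 1 ≤ S
    · left; constructor <;> omega
    · right; exact ⟨hi, by omega⟩

/-! ## §5 Finite-sum bookkeeping -/

omit [Group G] [TopologicalSpace G] [IsTopologicalGroup G] [CompactSpace G] [MeasurableSpace G]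
  [BorelSpace G] in
/-- Two distinct non-negative entries are dominated by the double sum. [folklore] -/
theorem two_le_sum (s : Finset ℕ) (T : Fin 4 → ℕ → ℝ) (hT : ∀ i j, 0 ≤ T i j) {iA iB : Fin 4}
    (hne : iA ≠ iB) {jA jB : ℕ} (hA : jA ∈ s) (hB : jB ∈ s) :
    T iA jA + T iB jB ≤ ∑ j ∈ s, ∑ i, T i j := by
  by_cases hj : jA = jB
  · subst hj
    calc T iA jA + T iB jA = ∑ i ∈ ({iA, iB} : Finset (Fin 4)), T i jA :=
          (Finset.sum_pair (f := fun i => T i jA) hne).symm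
      _ ≤ ∑ i, T i jA :=
          Finset.sum_le_sum_of_subset_of_nonneg (Finset.subset_univ _) fun i _ _ => hT i jA
      _ ≤ ∑ j ∈ s, ∑ i, T i j :=
          Finset.single_le_sum (f := fun j => ∑ i, T i j)
            (fun j _ => Finset.sum_nonneg fun i _ => hT i j) hA
  · calc T iA jA + T iB jB ≤ (∑ i, T i jA) + ∑ i, T i jB :=
          add_le_add (Finset.single_le_sum (f := fun i => T i jA) (fun i _ => hT i jA)
              (Finset.mem_univ iA))
            (Finset.single_le_sum (f := fun i => T i jB) (fun i _ => hT i jB) (Finset.mem_univ iB))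
      _ = ∑ j ∈ ({jA, jB} : Finset ℕ), ∑ i, T i j := (Finset.sum_pair (f := fun j => ∑ i, T i j) hj).symm
      _ ≤ ∑ j ∈ s, ∑ i, T i j :=
          Finset.sum_le_sum_of_subset_of_nonneg
            (by simp [Finset.insert_subset_iff, hA, hB])
            fun j _ _ => Finset.sum_nonneg fun i _ => hT i j

/-! ## §6 The stub: `OddTorusRPCauchySchwarz → MirrorDominationAxis0` -/

/-- **STUB 2b (`stub_mirrorDominationAxis0`), verbatim registered signature**: centred RP Cauchy–Schwarz in
every plane (STUB 2a) ⇒ mirror domination along the time axis, positive orientation; witnesses `k = 4`,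
`(P, Q) = (A, A^R), (A^R, A), (B^R, B), (B, B^R)`, `c = 1/2`, `w = R_A + R_B + 1`, `n₀ = 3(R_A + R_B) + 3`,
plane `p = ⌊(n + R_A - R_B)/2⌋`, lags `2p+1` and `2n-2p-1` (wrapped to `2S+1-m` with the swapped pair when `> S`). [folklore] -/
theorem mirrorDominationAxis0 : (∀ (G : Type) [Group G] [TopologicalSpace G] [IsTopologicalGroup G] [CompactSpace G] [MeasurableSpace G] [BorelSpace G] (N : ℕ) (ρ : G →* Matrix (Fin N) (Fin N) ℂ), Continuous ρ → ∀ (β : ℝ), 0 ≤ β → ∀ (S : ℕ), 1 ≤ S → ∀ (π : Equiv.Perm (Fin 4)) (v : Literature.MathematicalPhysics.QuantumFieldTheory.Site 4 (2 * S + 1)) (F G' : Literature.MathematicalPhysics.QuantumFieldTheory.GaugeConfig 4 (2 * S + 1) G → ℝ), Measurable F → Measurable G' → (∃ C : ℝ, ∀ U, |F U| ≤ C) → (∃ C : ℝ, ∀ U, |G' U| ≤ C) → DependsOn F {e : Literature.MathematicalPhysics.QuantumFieldTheory.Edge 4 (2 * S + 1) | Literature.MathematicalPhysics.QuantumFieldTheory.WilsonOddRP.IsOPosEdge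 (Literature.MathematicalPhysics.QuantumFieldTheory.sitePerm π.symm (e.1 - v), π.symm e.2) ∨ Literature.MathematicalPhysics.QuantumFieldTheory.WilsonOddRP.IsOSharedEdge (Literature.MathematicalPhysics.QuantumFieldTheory.sitePerm π.symm (e.1 - v), π.symm e.2)} → DependsOn G' {e : Literature.MathematicalPhysics.QuantumFieldTheory.Edge 4 (2 * S + 1) | Literature.MathematicalPhysics.QuantumFieldTheory.WilsonOddRP.IsOPosEdge (Literature.MathematicalPhysics.QuantumFieldTheory.sitePerm π.symm (e.1 - v), π.symm e.2) ∨ Literature.MathematicalPhysics.QuantumFieldTheory.WilsonOddRP.IsOSharedEdge (Literature.MathematicalPhysics.QuantumFieldTheory.sitePerm π.symm (e.1 - v), π.symm e.2)} → 0 ≤ ProbabilityTheory.covariance (fun U => F (Literature.MathematicalPhysics.QuantumFieldTheory.torusConfigShift v (Literature.MathematicalPhysics.QuantumFieldTheory.configPerm π (Literature.MathematicalPhysics.QuantumFieldTheory.GaugeConfig.timeReflect (Literature.MathematicalPhysics.QuantumFieldTheory.configPerm π.symm (Literature.MathematicalPhysics.QuantumFieldTheory.torusConfigShift (-v) U))))))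 F (Literature.MathematicalPhysics.QuantumFieldTheory.wilsonMeasure (d := 4) (L := 2 * S + 1) ρ β) ∧ 0 ≤ ProbabilityTheory.covariance (fun U => G' (Literature.MathematicalPhysics.QuantumFieldTheory.torusConfigShift v (Literature.MathematicalPhysics.QuantumFieldTheory.configPerm π (Literature.MathematicalPhysics.QuantumFieldTheory.GaugeConfig.timeReflect (Literature.MathematicalPhysics.QuantumFieldTheory.configPerm π.symm (Literature.MathematicalPhysics.QuantumFieldTheory.torusConfigShift (-v) U)))))) G' (Literature.MathematicalPhysics.QuantumFieldTheory.wilsonMeasure (d := 4) (L := 2 * S + 1) ρ β) ∧ (ProbabilityTheory.covariance (fun U => F (Literature.MathematicalPhysics.QuantumFieldTheory.torusConfigShift v (Literature.MathematicalPhysics.QuantumFieldTheory.configPerm π (Literature.MathematicalPhysics.QuantumFieldTheory.GaugeConfig.timeReflect (Literature.MathematicalPhysics.QuantumFieldTheory.configPerm π.symm (Literature.MathematicalPhysics.QuantumFieldTheory.torusConfigShift (-v) U)))))) G' (Literature.MathematicalPhysics.QuantumFieldTheory.wilsonMeasure (d := 4) (L := 2 * S + 1) ρ β)) ^ 2 ≤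 ProbabilityTheory.covariance (fun U => F (Literature.MathematicalPhysics.QuantumFieldTheory.torusConfigShift v (Literature.MathematicalPhysics.QuantumFieldTheory.configPerm π (Literature.MathematicalPhysics.QuantumFieldTheory.GaugeConfig.timeReflect (Literature.MathematicalPhysics.QuantumFieldTheory.configPerm π.symm (Literature.MathematicalPhysics.QuantumFieldTheory.torusConfigShift (-v) U)))))) F (Literature.MathematicalPhysics.QuantumFieldTheory.wilsonMeasure (d := 4) (L := 2 * S + 1) ρ β) * ProbabilityTheory.covariance (fun U => G' (Literature.MathematicalPhysics.QuantumFieldTheory.torusConfigShift v (Literature.MathematicalPhysics.QuantumFieldTheory.configPerm π (Literature.MathematicalPhysics.QuantumFieldTheory.GaugeConfig.timeReflect (Literature.MathematicalPhysics.QuantumFieldTheory.configPerm π.symm (Literature.MathematicalPhysics.QuantumFieldTheory.torusConfigShift (-v) U)))))) G' (Literature.MathematicalPhysics.QuantumFieldTheory.wilsonMeasure (d := 4) (L := 2 * S + 1) ρ β)) → ∀ (G : Type) [Group G] [TopologicalSpace G] [IsTopologicalGroup G] [CompactSpace G] [MeasurableSpace G] [BorelSpace G] (r : Literature.MathematicalPhysics.QuantumFieldTheory.LatticeRep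 G) (β : ℝ), 0 ≤ β → ∀ A B : Literature.MathematicalPhysics.QuantumFieldTheory.YMSpecies G, ∃ (k : ℕ) (P Q : Fin k → Literature.MathematicalPhysics.QuantumFieldTheory.YMSpecies G) (c : ℝ) (w n₀ : ℕ), 0 ≤ c ∧ ∀ S : ℕ, ∀ x ∈ Literature.Probability.LatticeModels.box 4 S, n₀ ≤ Literature.Probability.LatticeModels.Site.supNorm x → x 0 = (Literature.Probability.LatticeModels.Site.supNorm x : ℤ) → |ProbabilityTheory.covariance (fun U => A.F (Literature.MathematicalPhysics.QuantumLattice.torusLift (2 * S + 1) U)) (fun U => B.F (Literature.MathematicalPhysics.QuantumLattice.configShift (-x) (Literature.MathematicalPhysics.QuantumLattice.torusLift (2 * S + 1) U))) (Literature.MathematicalPhysics.QuantumFieldTheory.wilsonMeasure (d := 4) (L := 2 * S + 1) r.ρ β)| ≤ c * ∑ j ∈ (Finset.range (S + 1)).filter (fun j => Literature.Probability.LatticeModels.Site.supNorm x ≤ j + w ∧ j ≤ Literature.Probability.LatticeModels.Site.supNorm x + w), ∑ i : Fin k, |ProbabilityTheory.covariance (fun U => (P i).F (Literature.MathematicalPhysics.QuantumLattice.torusLift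 (2 * S + 1) U)) (fun U => (Q i).F (Literature.MathematicalPhysics.QuantumLattice.configShift (-(Pi.single 0 (j : ℤ))) (Literature.MathematicalPhysics.QuantumLattice.torusLift (2 * S + 1) U))) (Literature.MathematicalPhysics.QuantumFieldTheory.wilsonMeasure (d := 4) (L := 2 * S + 1) r.ρ β)| := by
  intro hCS G _ _ _ _ _ _ r β hβ A B
  classical
  -- crude time extents of the two supports
  set RA : ℕ := A.supp.sup (fun e => (e.1 0).natAbs) + 1 with hRA_def
  set RB : ℕ := B.supp.sup (fun e => (e.1 0).natAbs) + 1 with hRB_def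
  have hRA : ∀ e ∈ A.supp, (e.1 0).natAbs + 1 ≤ RA := fun e he =>
    Nat.succ_le_succ (Finset.le_sup
      (f := fun e : Literature.MathematicalPhysics.QuantumLattice.ZdEdge 4 => (e.1 0).natAbs) he)
  have hRB : ∀ e ∈ B.supp, (e.1 0).natAbs + 1 ≤ RB := fun e he =>
    Nat.succ_le_succ (Finset.le_sup
      (f := fun e : Literature.MathematicalPhysics.QuantumLattice.ZdEdge 4 => (e.1 0).natAbs) he)
  refine ⟨4, ![A, reflSpecies A, reflSpecies B, B], ![reflSpecies A, A, B, reflSpecies B], 1 / 2,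
    RA + RB + 1, 3 * (RA + RB) + 3, by norm_num, ?_⟩
  intro S x hx hn0 hx0
  -- arithmetic of the placement
  have hnS : Site.supNorm x ≤ S := mem_box_iff_supNorm_le.1 hx
  set n : ℕ := Site.supNorm x with hn_def
  have hS1 : 1 ≤ S := by omega
  set p : ℤ := ((n : ℤ) + RA - RB) / 2 with hp_def
  have hp1 : 2 * p ≤ (n : ℤ) + RA - RB := by omega
  have hp2 : (n : ℤ) + RA - RB < 2 * p + 2 := by omega
  haveI : IsProbabilityMeasure (wilsonMeasure (d := 4) (L := 2 * S + 1) r.ρ β) :=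
    isProbabilityMeasure_wilsonMeasure _ r.continuous β
  -- the transported reflection in the plane `p + ½`
  set Θ : GaugeConfig 4 (2 * S + 1) G → GaugeConfig 4 (2 * S + 1) G := fun U =>
    torusConfigShift (Torus.proj (2 * S + 1) (Pi.single 0 p)) (configPerm (1 : Equiv.Perm (Fin 4))
      (GaugeConfig.timeReflect (configPerm (1 : Equiv.Perm (Fin 4)).symm
        (torusConfigShift (-Torus.proj (2 * S + 1) (Pi.single 0 p)) U)))) with hΘ_def
  have h1 : (1 : Equiv.Perm (Fin 4)).symm = 1 := rfl
  have hΘΘ : ∀ U, Θ (Θ U) = U := by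
    intro U
    have hc : ∀ (w : Literature.MathematicalPhysics.QuantumFieldTheory.Site 4 (2 * S + 1))
        (W : GaugeConfig 4 (2 * S + 1) G), torusConfigShift (-w) (torusConfigShift w W) = W := by
      intro w W; funext e; simp [torusConfigShift_apply]
    have hc' : ∀ (w : Literature.MathematicalPhysics.QuantumFieldTheory.Site 4 (2 * S + 1))
        (W : GaugeConfig 4 (2 * S + 1) G), torusConfigShift w (torusConfigShift (-w) W) = W := by
      intro w W; funext e; simp [torusConfigShift_apply]
    have hTT : ∀ W : GaugeConfig 4 (2 * S + 1) G, W.timeReflect.timeReflect = W := by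
      intro W
      funext e
      have h2 : (WilsonRP.edgeReflect e).2 = e.2 := by
        unfold WilsonRP.edgeReflect
        split_ifs with h <;> simp [h]
      rw [WilsonRP.timeReflect_apply, WilsonRP.timeReflect_apply, h2]
      split_ifs with h
      · rw [WilsonRP.edgeReflect_edgeReflect, inv_inv]
      · rw [WilsonRP.edgeReflect_edgeReflect]
    simp only [hΘ_def, h1, configPerm_one, hc, hTT, hc']
  have hΘm : Measurable Θ :=
    (torusConfigShift _).measurable.comp ((configPerm _).measurable.comp
      (WilsonRP.measurable_timeReflect.comp ((configPerm _).measurable.comp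
        (torusConfigShift _).measurable)))
  -- the two half-space functions
  set F : GaugeConfig 4 (2 * S + 1) G → ℝ := fun U => A.F (torusLift (2 * S + 1) (Θ U)) with hF_def
  set G' : GaugeConfig 4 (2 * S + 1) G → ℝ := fun U =>
    B.F (configShift (-x) (torusLift (2 * S + 1) U)) with hG_def
  have hFeq : ∀ U, F U =
      (reflSpecies A).F (configShift (-Pi.single 0 (2 * p + 1)) (torusLift (2 * S + 1) U)) :=
    fun U => F_eq A (2 * S + 1) p U
  have hFfun : F = fun U =>
      (reflSpecies A).F (configShift (-Pi.single 0 (2 * p + 1)) (torusLift (2 * S + 1) U)) :=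
    funext hFeq
  obtain ⟨a, ha⟩ := A.bounded
  obtain ⟨b, hb⟩ := B.bounded
  have hFm : Measurable F := A.measurable.comp ((measurable_torusLift _).comp hΘm)
  have hGm : Measurable G' := B.measurable.comp ((configShift _).measurable.comp (measurable_torusLift _))
  have hFdep := dependsOn_F (G := G) A S p RA hRA (by omega) (by omega)
  rw [← hFfun] at hFdep
  have hGdep := dependsOn_G (G := G) B S hS1 x p RB hRB (by omega) (by omega)
  obtain ⟨hDA, hDB, hCS2⟩ := hCS G r.N r.ρ r.continuous β hβ S hS1 (1 : Equiv.Perm (Fin 4))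
    (Torus.proj (2 * S + 1) (Pi.single 0 p)) F G' hFm hGm ⟨a, fun U => ha _⟩ ⟨b, fun U => hb _⟩
    hFdep hGdep
  -- `F ∘ Θ = A ∘ lift`
  have hFΘ : (fun U => F (Θ U)) = fun U => A.F (torusLift (2 * S + 1) U) := by
    funext U; simp only [hF_def, hΘΘ]
  change 0 ≤ cov[fun U => F (Θ U), F; _] at hDA
  change 0 ≤ cov[fun U => G' (Θ U), G'; _] at hDB
  change cov[fun U => F (Θ U), G'; _] ^ 2 ≤ cov[fun U => F (Θ U), F; _] * cov[fun U => G' (Θ U), G'; _]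
    at hCS2
  rw [hFΘ] at hDA hCS2
  -- AM–GM
  set c := cov[fun U => A.F (torusLift (2 * S + 1) U), G'; wilsonMeasure (d := 4) (L := 2 * S + 1) r.ρ β]
  set DA := cov[fun U => A.F (torusLift (2 * S + 1) U), F; wilsonMeasure (d := 4) (L := 2 * S + 1) r.ρ β]
  set DB := cov[fun U => G' (Θ U), G'; wilsonMeasure (d := 4) (L := 2 * S + 1) r.ρ β]
  have key : |c| ≤ (DA + DB) / 2 := by
    rw [abs_le]
    constructor
    · nlinarith [sq_nonneg (DA - DB), hCS2, hDA, hDB, sq_nonneg (c + (DA + DB) / 2)]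
    · nlinarith [sq_nonneg (DA - DB), hCS2, hDA, hDB, sq_nonneg (c - (DA + DB) / 2)]
  -- identification of the two mirror terms
  have hDAeq : DA = cov[fun U => A.F (torusLift (2 * S + 1) U),
      fun U => (reflSpecies A).F (configShift (-Pi.single 0 (2 * p + 1)) (torusLift (2 * S + 1) U));
      wilsonMeasure (d := 4) (L := 2 * S + 1) r.ρ β] := by
    simp only [DA, hFfun]
  have hxw : (-x - siteReflect (-x + Pi.single 0 (2 * p + 1)) : Site 4) =
      -Pi.single 0 (2 * (n : ℤ) - 2 * p - 1) := by
    funext k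
    by_cases hk : k = 0
    · subst hk; simp [hx0]; ring
    · simp [siteReflect_apply_of_ne _ hk, hk]
  have hDBeq : DB = cov[fun U => (reflSpecies B).F (torusLift (2 * S + 1) U),
      fun U => B.F (configShift (-Pi.single 0 (2 * (n : ℤ) - 2 * p - 1)) (torusLift (2 * S + 1) U));
      wilsonMeasure (d := 4) (L := 2 * S + 1) r.ρ β] := by
    have hGΘ : (fun U => G' (Θ U)) = fun U => (reflSpecies B).F
        (configShift (siteReflect (-x + Pi.single 0 (2 * p + 1))) (torusLift (2 * S + 1) U)) := by
      funext U; exact G_theta_eq B (2 * S + 1) p x U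
    have e1 : DB = cov[fun U => G' (Θ U), G'; wilsonMeasure (d := 4) (L := 2 * S + 1) r.ρ β] := rfl
    rw [e1, hGΘ, hG_def]
    have e2 := cov_rebase r β S (reflSpecies B).F B.F (siteReflect (-x + Pi.single 0 (2 * p + 1))) (-x)
    rw [hxw] at e2
    exact e2
  -- the lags and their torus normal forms
  set m₁ : ℤ := 2 * p + 1 with hm₁
  set m₂ : ℤ := 2 * (n : ℤ) - 2 * p - 1 with hm₂
  -- the family terms
  set T : Fin 4 → ℕ → ℝ := fun i j =>
    |cov[fun U => ((![A, reflSpecies A, reflSpecies B, B] : Fin 4 → YMSpecies G) i).F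
        (torusLift (2 * S + 1) U),
      fun U => ((![reflSpecies A, A, B, reflSpecies B] : Fin 4 → YMSpecies G) i).F
        (configShift (-(Pi.single 0 (j : ℤ))) (torusLift (2 * S + 1) U));
      wilsonMeasure (d := 4) (L := 2 * S + 1) r.ρ β]| with hT_def
  have hT0 : ∀ i j, 0 ≤ T i j := fun i j => abs_nonneg _
  -- DA is a family term
  have hA : ∃ (iA : Fin 4) (jA : ℕ), (iA = 0 ∨ iA = 1) ∧ jA ≤ S ∧ n ≤ jA + (RA + RB + 1) ∧
      jA ≤ n + (RA + RB + 1) ∧ DA ≤ T iA jA := by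
    by_cases hle : m₁ ≤ S
    · refine ⟨0, m₁.toNat, Or.inl rfl, by omega, by omega, by omega, ?_⟩
      have hj : ((m₁.toNat : ℕ) : ℤ) = m₁ := Int.toNat_of_nonneg (by omega)
      rw [hDAeq]
      refine (le_abs_self _).trans (le_of_eq ?_)
      simp only [hT_def, hj]
      rfl
    · refine ⟨1, (2 * S + 1 - m₁).toNat, Or.inr rfl, by omega, by omega, by omega, ?_⟩
      have hj : (((2 * S + 1 - m₁).toNat : ℕ) : ℤ) = 2 * S + 1 - m₁ := Int.toNat_of_nonneg (by omega)
      rw [hDAeq, cov_wrap r β S _ _ m₁ _ hj]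
      refine (le_abs_self _).trans (le_of_eq ?_)
      simp only [hT_def]
      rfl
  have hB : ∃ (iB : Fin 4) (jB : ℕ), (iB = 2 ∨ iB = 3) ∧ jB ≤ S ∧ n ≤ jB + (RA + RB + 1) ∧
      jB ≤ n + (RA + RB + 1) ∧ DB ≤ T iB jB := by
    by_cases hle : m₂ ≤ S
    · refine ⟨2, m₂.toNat, Or.inl rfl, by omega, by omega, by omega, ?_⟩
      have hj : ((m₂.toNat : ℕ) : ℤ) = m₂ := Int.toNat_of_nonneg (by omega)
      rw [hDBeq]
      refine (le_abs_self _).trans (le_of_eq ?_)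
      simp only [hT_def, hj]
      rfl
    · refine ⟨3, (2 * S + 1 - m₂).toNat, Or.inr rfl, by omega, by omega, by omega, ?_⟩
      have hj : (((2 * S + 1 - m₂).toNat : ℕ) : ℤ) = 2 * S + 1 - m₂ := Int.toNat_of_nonneg (by omega)
      rw [hDBeq, cov_wrap r β S _ _ m₂ _ hj]
      refine (le_abs_self _).trans (le_of_eq ?_)
      simp only [hT_def]
      rfl
  obtain ⟨iA, jA, hiA, hjA, hjA1, hjA2, hDAle⟩ := hA
  obtain ⟨iB, jB, hiB, hjB, hjB1, hjB2, hDBle⟩ := hB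
  have hne : iA ≠ iB := by
    rcases hiA with rfl | rfl <;> rcases hiB with rfl | rfl <;> decide
  have hmemA : jA ∈ (Finset.range (S + 1)).filter
      (fun j => Site.supNorm x ≤ j + (RA + RB + 1) ∧ j ≤ Site.supNorm x + (RA + RB + 1)) :=
    Finset.mem_filter.2 ⟨Finset.mem_range.2 (by omega), by omega, by omega⟩
  have hmemB : jB ∈ (Finset.range (S + 1)).filter
      (fun j => Site.supNorm x ≤ j + (RA + RB + 1) ∧ j ≤ Site.supNorm x + (RA + RB + 1)) :=
    Finset.mem_filter.2 ⟨Finset.mem_range.2 (by omega), by omega, by omega⟩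
  have hsum := two_le_sum _ T hT0 hne hmemA hmemB
  change |c| ≤ 1 / 2 * ∑ j ∈ (Finset.range (S + 1)).filter
      (fun j => Site.supNorm x ≤ j + (RA + RB + 1) ∧ j ≤ Site.supNorm x + (RA + RB + 1)), ∑ i, T i j
  linarith

end Species

end Summit.QuantumFields.YangMills.Cruxes.FiniteSusceptibilityWeakCoupling.SupAxisReflectionTransfer.MirrorCore

end
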